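import Summits.ResolutionOfSingularities.ResolutionOfSingularities.Theorems.FrobeniusClosingPatchingRelPerfectTwoPlanesSideZero
import HarnessLib

/-!
# Crux `PatchingRelPerfect` (stmt-ResolutionOfSingularities-16161), chain w52 — the rank-two member
# `f = x₀x₁ + x₂³`: the chart `B₀` is RESOLVED by the REPAIRED companion `𝔪ᴺ·A·J_q·A₃·A₄` (unconditional)

[OURS · L1 W5.2 · rung] On `B₀` (`u = x₀`) the point avatar `J_q = (x₀) + (x₁,x₂)(x₁,x₂,x₃) + (x₃³)` of the
repaired companion (design note NEXT-two-planes-cube.md, Addenda 9–10; kit j286610) is CARTIER: `J_q B₀ = (u)`.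
Hence `(𝔪ᴺ · A · J_q · A₃ · A₄ · I) B₀ = (u)^{N+3} · (A₃ · A₄ · I) B₀` and `…TwoPlanesSideZero` applies.

* `map_chartBase_tpJq_zero` — `J_q B₀ = (u)`;
* `map_tpAllJq_zero`, `isRegular_of_isBlowup_tpAllJq_zero` — the `B₀` input of the final rung.

Nothing here is a statement of the manuscript under review.

## References

* The Stacks Project, Tags 080A, 080B. [StacksProject]
-/

-- `Summit.<Summit>.<Sub>.Theorems` with `Sub = Summit` (single-conjunct summit, D-0017)
set_option linter.dupNamespace false

noncomputable section

open CategoryTheory CategoryTheory.Limits AlgebraicGeometry Literature.AlgebraicGeometry.Resolution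
open IsLocalRing

namespace Summit.ResolutionOfSingularities.ResolutionOfSingularities.Theorems

namespace TwoPlanesRung

open ConeRung

universe u

/-- Reordering the twisted factors on `B₀`. [folklore] -/
theorem tp_allJq_product_zero {B : Type*} [CommRing B] (W P3 P4 PI : Ideal B) (N : ℕ) :
    W ^ N * W ^ 2 * W * P3 * P4 * PI = W ^ (N + 3) * (P3 * P4 * PI) := by
  ring

section ChartZeroJq

variable {S : Type u} [CommRing S] [IsRegularLocalRing S] (x : Fin 4 → S)
  (hx : Ideal.span (Set.range x) = IsLocalRing.maximalIdeal S)
  (hd : (IsLocalRing.maximalIdeal S).spanFinrank = 4)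

local notation3 (prettyPrint := false) "M" => Ideal.span (Set.range x)
local notation3 (prettyPrint := false) "fT" => x 0 * x 1 + x 2 ^ 3
local notation3 (prettyPrint := false) "φ" => chartBase x 0
local notation3 (prettyPrint := false) "U" => Ideal.span {chartBase x 0 (x 0)}
local notation3 (prettyPrint := false) "tpJq" => Ideal.span {x 0} ⊔ Ideal.span {x 1, x 2} * Ideal.span {x 1, x 2, x 3} ⊔
  Ideal.span {x 3 ^ 3}

omit [IsRegularLocalRing S] in
/-- **`J_q B₀ = (u)`** (`x₀ ↦ u`, the other generators are multiples of `u`). [cite: StacksProject, Tag 080B] -/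
theorem map_chartBase_tpJq_zero : (tpJq).map φ = U := by
  have hu : chartBase x 0 (x 0) ∈ U := Ideal.mem_span_singleton_self _
  have hx0 : (Ideal.span {x 0}).map φ = U := by
    rw [map_chartBase_span_x0, Ideal.span_singleton_eq_top.mpr (isUnit_e0 x), Ideal.mul_top]
  have hP : (Ideal.span {x 1, x 2}).map φ ≤ U := by
    rw [Ideal.map_span, Set.image_insert_eq, Set.image_singleton, reesChartBase_apply_eq_mul_chartGen x 0 1,
      reesChartBase_apply_eq_mul_chartGen x 0 2, Ideal.span_le]
    rintro _ (rfl | rfl)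
    · exact Ideal.mul_mem_right _ _ hu
    · exact Ideal.mul_mem_right _ _ hu
  have h3 : (Ideal.span {x 3 ^ 3}).map φ ≤ U := by
    rw [Ideal.map_span, Set.image_singleton, map_pow, reesChartBase_apply_eq_mul_chartGen x 0 3,
      Ideal.span_singleton_le_iff_mem]
    exact Ideal.pow_mem_of_mem U (Ideal.mul_mem_right _ _ hu) 3 (by norm_num)
  rw [Ideal.map_sup, Ideal.map_sup, Ideal.map_mul, hx0]
  exact le_antisymm (sup_le (sup_le le_rfl (Ideal.mul_le_right.trans hP)) h3)
    (le_sup_of_le_left le_sup_left)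

omit [IsRegularLocalRing S] in
/-- **`𝔪ᴺ · A · J_q · A₃ · A₄ · I ↦ (u)^{N+3} · (A₃ · A₄ · I) B₀`** on `B₀`. [cite: StacksProject, Tag 080B] -/
theorem map_tpAllJq_zero (N : ℕ) :
    (M ^ N * (Ideal.span {fT} ⊔ Ideal.span {x 0} * M ⊔ M ^ 3) * tpJq * (Ideal.span {fT} ⊔ M ^ 3) *
        (Ideal.span {fT} ⊔ Ideal.span {x 0} * M ^ 2 ⊔ M ^ 4) * (Ideal.span {fT} ⊔ M ^ 4)).map φ =
      U ^ (N + 3) * (((Ideal.span {fT} ⊔ M ^ 3) * (Ideal.span {fT} ⊔ Ideal.span {x 0} * M ^ 2 ⊔ M ^ 4) *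
        (Ideal.span {fT} ⊔ M ^ 4)).map φ) := by
  rw [Ideal.map_mul, Ideal.map_mul, Ideal.map_mul, Ideal.map_mul, Ideal.map_mul, Ideal.map_pow,
    ConeRung.map_chartBase_M, map_tpA_zero, map_chartBase_tpJq_zero, Ideal.map_mul, Ideal.map_mul]
  exact tp_allJq_product_zero _ _ _ _ N

include hx hd in
/-- **The chart `B₀` of the rank-two member is resolved by the repaired companion** (unconditional).
[cite: StacksProject, Tag 080A] [cite: StacksProject, Tag 080B] -/
theorem isRegular_of_isBlowup_tpAllJq_zero (N : ℕ) {Y : Scheme.{u}} {ρ : Y ⟶ Spec (.of (chartRing x 0))}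
    (hρ : IsBlowup ρ (affineBlowup.idealSheaf
      ((M ^ N * (Ideal.span {fT} ⊔ Ideal.span {x 0} * M ⊔ M ^ 3) * tpJq * (Ideal.span {fT} ⊔ M ^ 3) *
        (Ideal.span {fT} ⊔ Ideal.span {x 0} * M ^ 2 ⊔ M ^ 4) * (Ideal.span {fT} ⊔ M ^ 4)).map φ))) :
    Scheme.IsRegular Y := by
  rw [map_tpAllJq_zero] at hρ
  exact isRegular_of_isBlowup_tpProd_zero x hx hd (N + 3) hρ

end ChartZeroJq

end TwoPlanesRung

end Summit.ResolutionOfSingularities.ResolutionOfSingularities.Theorems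

end
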